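import Summits.BirchSwinnertonDyer.BirchSwinnertonDyer.Theorems.Rank2ObservatoryRank3PSat3Census
import Summits.BirchSwinnertonDyer.BirchSwinnertonDyer.Theorems.Rank2ObservatoryRank3PSat5Census
import Summits.BirchSwinnertonDyer.BirchSwinnertonDyer.Theorems.Rank2ObservatoryRank3PSat7Census
import HarnessLib

/-!
# BirchSwinnertonDyer — rank ≥ 2 observatory: rank-3 saturation censuses JOINED (index prime to 210)

HONEST FRAMING: per-curve certified theorems and census instruments; no claim on BSD in rank ≥ 2.

THE JOIN of the four kernel-certified saturation censuses of the rank-3 table (`2`: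
`SatCensus.finiteIndex_and_odd_index_of_mem_rows`; `3`: `PSatCensus3.index_coprime_six_of_mem_rows`;
`5`: `PSatCensus5.index_coprime_ten_of_mem_rows`; `7`:
`PSatCensus7.index_coprime_fourteen_of_mem_rows`) with the GRAND rank census
(`Rank2ObservatoryRank3KernelRankCensusN9365.rows`, `rank_ℤ E(ℚ) = 3`): for EVERY row the listed
span `ℤP₁ + ℤP₂ + ℤP₃ + E(ℚ)_tors` has finite index PRIME TO `210` in `E(ℚ)` — every prime factor
of the index `[E(ℚ) : ℤP₁ + ℤP₂ + ℤP₃ + E(ℚ)_tors]` is `≥ 11`; equivalently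
`Reg(P₁, P₂, P₃) = n² · Reg(E(ℚ)/tors)` with `gcd(n, 210) = 1`; and, under the single NAMED numeric
hypothesis `index ≤ 10` (engine DATA, true for 151 rows by the two-engine height bound), the listed
points and the torsion generate `E(ℚ)` (`listedSpan_eq_top_of_index_le_ten`). No definitions, no
`decide` on data (pure glue of landed theorems). To be filed only after the `5`- and `7`-censuses
have landed.

References: Cremona, *Algorithms for Modular Elliptic Curves* (1997) §3.5; Siksek, Rocky Mountain
J. Math. 25 (1995) §3; Silverman, *The Arithmetic of Elliptic Curves* (2009) VIII.6.7.
-/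

-- single-conjunct summit: `Summit.BirchSwinnertonDyer.BirchSwinnertonDyer.…` repeats the name
set_option linter.dupNamespace false

namespace Summit.BirchSwinnertonDyer.BirchSwinnertonDyer.Rank2Observatory

namespace PSatCensus357

open Rank3KernelRankCensusN9365 (rows mem_rank3Table rank_eq_three)

/-- A natural number prime to `210` has all prime factors `≥ 11`. [folklore] -/
theorem eleven_le_of_prime_dvd {n p : ℕ} (h2 : ¬ 2 ∣ n) (h3 : ¬ 3 ∣ n) (h5 : ¬ 5 ∣ n)
    (h7 : ¬ 7 ∣ n) (hp : p.Prime) (hd : p ∣ n) : 11 ≤ p := by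
  by_contra hlt
  have hlt' : p < 11 := Nat.lt_of_not_le hlt
  have h2p := hp.two_le
  interval_cases p
  · exact h2 hd
  · exact h3 hd
  · exact absurd hp (by decide)
  · exact h5 hd
  · exact absurd hp (by decide)
  · exact h7 hd
  · exact absurd hp (by decide)
  · exact absurd hp (by decide)
  · exact absurd hp (by decide)

/-- A nonzero natural number `< 11` prime to `210` is `1`. [folklore] -/
theorem eq_one_of_lt_eleven {n : ℕ} (hn : n ≠ 0) (h2 : ¬ 2 ∣ n) (h3 : ¬ 3 ∣ n) (h5 : ¬ 5 ∣ n)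
    (h7 : ¬ 7 ∣ n) (hlt : n < 11) : n = 1 := by
  interval_cases n <;> omega

/-- **THE JOIN: index prime to `210`.** For EVERY row of the GRAND rank census (`rank_ℤ E(ℚ) = 3`,
9365 rows) the listed span `ℤP₁ + ℤP₂ + ℤP₃ + E(ℚ)_tors` has finite index in `E(ℚ)` divisible by
none of `2, 3, 5, 7`. [cite: CremonaAlgorithms1997, §3.5] [cite: SilvermanAEC2009, Thm. VIII.6.7] -/
theorem index_coprime_210_of_mem_rows {r : Rank3Row} (hr : r ∈ rows) (h : r.check = true) :
    (AddSubgroup.closure {r.gen₁ h, r.gen₂ h, r.gen₃ h} ⊔ AddCommGroup.torsion _).FiniteIndex ∧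
      ¬ 2 ∣ (AddSubgroup.closure {r.gen₁ h, r.gen₂ h, r.gen₃ h} ⊔ AddCommGroup.torsion _).index ∧
      ¬ 3 ∣ (AddSubgroup.closure {r.gen₁ h, r.gen₂ h, r.gen₃ h} ⊔ AddCommGroup.torsion _).index ∧
      ¬ 5 ∣ (AddSubgroup.closure {r.gen₁ h, r.gen₂ h, r.gen₃ h} ⊔ AddCommGroup.torsion _).index ∧
      ¬ 7 ∣ (AddSubgroup.closure {r.gen₁ h, r.gen₂ h, r.gen₃ h} ⊔ AddCommGroup.torsion _).index :=
  by
  obtain ⟨hfi, h2, h3⟩ := PSatCensus3.index_coprime_six_of_mem_rows hr h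
  exact ⟨hfi, h2, h3, (PSatCensus5.index_coprime_ten_of_mem_rows hr h).2.2,
    (PSatCensus7.index_coprime_fourteen_of_mem_rows hr h).2.2⟩

/-- **Every prime factor of the index is `≥ 11`**, for every row of the GRAND rank census.
[cite: CremonaAlgorithms1997, §3.5] -/
theorem eleven_le_of_prime_dvd_index {r : Rank3Row} (hr : r ∈ rows) (h : r.check = true)
    {p : ℕ} (hp : p.Prime)
    (hd : p ∣ (AddSubgroup.closure {r.gen₁ h, r.gen₂ h, r.gen₃ h} ⊔ AddCommGroup.torsion _).index) :
    11 ≤ p := by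
  obtain ⟨_, h2, h3, h5, h7⟩ := index_coprime_210_of_mem_rows hr h
  exact eleven_le_of_prime_dvd h2 h3 h5 h7 hp hd

/-- **GENERATORS under ONE named numeric hypothesis.** If the index bound of a GRAND row is
`≤ 10` — `hB`, engine DATA: the two-engine Cremona–Siksek height bound `m_max` of the MW-index
certificate (cell anomaly register J11, `satb-table.tsv`; `m_max ≤ 10` for 151 of the 9487 table
rows, `≤ 7` for 64; median 99, max 17237) — then the listed points and the torsion GENERATE:
`E(ℚ) = ℤP₁ + ℤP₂ + ℤP₃ + E(ℚ)_tors` (the index has no prime factor `< 11`, so it is `1`). For every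
other row the kernel statement is `eleven_le_of_prime_dvd_index`, and "index `= 1`" stays the
two-engine satB certificate (DATA, not a theorem). [cite: CremonaAlgorithms1997, §3.5] -/
theorem listedSpan_eq_top_of_index_le_ten {r : Rank3Row} (hr : r ∈ rows) (h : r.check = true)
    (hB : (AddSubgroup.closure {r.gen₁ h, r.gen₂ h, r.gen₃ h} ⊔ AddCommGroup.torsion _).index ≤ 10) :
    AddSubgroup.closure {r.gen₁ h, r.gen₂ h, r.gen₃ h} ⊔ AddCommGroup.torsion _ = ⊤ := by
  obtain ⟨hfi, h2, h3, h5, h7⟩ := index_coprime_210_of_mem_rows hr h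
  haveI := hfi
  exact AddSubgroup.index_eq_one.mp
    (eq_one_of_lt_eleven AddSubgroup.FiniteIndex.index_ne_zero h2 h3 h5 h7 (by omega))

/-- The JOIN phrased with the certified rank: `rank_ℤ E(ℚ) = 3` AND the listed span has finite index
prime to `210`. [cite: CremonaAlgorithms1997, §3.5] -/
theorem rank_three_and_index_coprime_210 {r : Rank3Row} (hr : r ∈ rows) (h : r.check = true) :
    r.curve.mordellWeilRank = 3 ∧
      (AddSubgroup.closure {r.gen₁ h, r.gen₂ h, r.gen₃ h} ⊔ AddCommGroup.torsion _).FiniteIndex ∧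
      ¬ 2 ∣ (AddSubgroup.closure {r.gen₁ h, r.gen₂ h, r.gen₃ h} ⊔ AddCommGroup.torsion _).index ∧
      ¬ 3 ∣ (AddSubgroup.closure {r.gen₁ h, r.gen₂ h, r.gen₃ h} ⊔ AddCommGroup.torsion _).index ∧
      ¬ 5 ∣ (AddSubgroup.closure {r.gen₁ h, r.gen₂ h, r.gen₃ h} ⊔ AddCommGroup.torsion _).index ∧
      ¬ 7 ∣ (AddSubgroup.closure {r.gen₁ h, r.gen₂ h, r.gen₃ h} ⊔ AddCommGroup.torsion _).index :=
  ⟨rank_eq_three r hr, index_coprime_210_of_mem_rows hr h⟩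

end PSatCensus357

end Summit.BirchSwinnertonDyer.BirchSwinnertonDyer.Rank2Observatory
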